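import Mathlib
import HarnessLib

/-!
# The between-replica τ estimate cannot pass Ruling 11's evidence gate at R ≤ 9 replicas (D-B26 point (4))

HONEST FRAMING: exact (Metropolis-corrected) sampling algorithms for lattice gauge theory;
figures of merit are autocorrelation/cost numbers at stated couplings and volumes; no
continuum-physics claim.

Venture `LatticeQCDFlow` (cell pub-lqcd), sub-topic `Scoring`; FANOUT row 11 (`eng-scorerA`),
row 11 GEN-14, 2026-08-22.  NEW WORK of the cell (elementary real arithmetic), not a published
result; nothing is cited as a fact.  Companion of `Scoring/ReplicaError` (the population statement
behind the between-replica standard error) and of the LEADERBOARD-2 docket item D-B26 / Ruling 11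
(HOME/eng-scorera/docket-D-B26/README-A.md § Point (4)).

## Content

Scorer A prints, for an observable measured on `R ≥ 4` replicas, the between-replica estimate
`τ_rep = s²_R / (2 Γ̂(0))` with the error it assigns to it, `δτ_rep = τ_rep · √(2/(R−1))` (the
relative scatter of a variance estimated from `R − 1` degrees of freedom; gamma.py `uwerr`).
Ruling 11 (D-B26, LEADERBOARD-2) replaces the Wolff-window value `τ_base ± δτ_base` by a
cross-estimator `τ_c ± δτ_c` only through ONE evidence gate, identical in both scorers:

  `τ_c − τ_base > 2 · hypot(δτ_base, δτ_c) = 2 · √(δτ_base² + δτ_c²)`.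

Point (4) of the A pen asked whether `τ_rep` should join the cross-estimator set on scorer A.  Typed
here is why, under that gate, the question is moot at the replica counts on which A prints `τ_rep`:

* `gate_fails_of_le_two_mul_err` — any candidate whose own error is at least half its value
  (`τ_c ≤ 2 δτ_c`) fails the gate against every `τ_base > 0`, whatever `δτ_base`;
* `one_le_two_mul_sqrt_iff` — for `R ≥ 2`: `1 ≤ 2 √(2/(R−1)) ↔ R ≤ 9`;
* **`replicaGate_fails`** — for `2 ≤ R ≤ 9` the gate with `δτ_rep = τ_rep √(2/(R−1))` is
  unsatisfiable (every `τ_base > 0`, every `δτ_base`, every real `τ_rep`) — this covers every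
  analysis on which A prints `τ_rep` today (chain mode, `R ∈ {4, 8}`);
* `ratio_gt_of_replicaGate` — necessary condition at any `R ≥ 2`: a pass forces
  `τ_base < τ_rep · (1 − 2 √(2/(R−1)))`; instances `replicaGate_R10_ratio` (`R = 10` ⇒
  `τ_rep > 17 τ_base`) and `replicaGate_R19_ratio` (`R = 19` ⇒ `τ_rep > 3 τ_base`);
* `replicaGate_satisfiable_of_ten_le` — sharpness: for every `R ≥ 10` the gate IS satisfiable
  (witness `τ_base = 1/20`, `δτ_base = 0`, `τ_rep = 1`), so the `R ≤ 9` hypothesis is not an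
  artefact of the proof;
* `l101_plaquette_replicaGate_fails` — the record instance (LEADERBOARD l.101, plaquette, `R = 4`:
  `τ_base = 6.599…`, `δτ_base = 0.156…`, `τ_rep = 23.681…`).

What is NOT typed: the `χ²_{R−1}` sampling law that motivates `√(2/(R−1))` (A's printed `δτ_rep`
is taken as given), and any statement about which estimate is closer to the true `τ_int`.
-/

namespace Summit.Ventures.LatticeQCDFlow.Scoring

/-- **A candidate at least half as uncertain as itself never passes the gate.**  If
`0 < τ_base`, `0 ≤ δ_c` and `τ_c ≤ 2 δ_c`, then `τ_c − τ_base > 2 √(δ_b² + δ_c²)` is false. -/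
theorem gate_fails_of_le_two_mul_err {τb τc δb δc : ℝ} (hτb : 0 < τb) (hδc : 0 ≤ δc)
    (h : τc ≤ 2 * δc) : ¬ (τc - τb > 2 * Real.sqrt (δb ^ 2 + δc ^ 2)) := by
  intro hgate
  have h1 : δc ≤ Real.sqrt (δb ^ 2 + δc ^ 2) := by
    calc δc = Real.sqrt (δc ^ 2) := (Real.sqrt_sq hδc).symm
      _ ≤ Real.sqrt (δb ^ 2 + δc ^ 2) := Real.sqrt_le_sqrt (by nlinarith [sq_nonneg δb])
  linarith

/-- For `R ≥ 2` replicas: `1 ≤ 2 √(2/(R−1))` holds exactly when `R ≤ 9`. -/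
theorem one_le_two_mul_sqrt_iff {R : ℕ} (hR : 2 ≤ R) :
    (1 : ℝ) ≤ 2 * Real.sqrt (2 / ((R : ℝ) - 1)) ↔ R ≤ 9 := by
  have hR1 : (0 : ℝ) < (R : ℝ) - 1 := by
    have : (2 : ℝ) ≤ (R : ℝ) := by exact_mod_cast hR
    linarith
  have hx : (0 : ℝ) ≤ 2 / ((R : ℝ) - 1) := by positivity
  constructor
  · intro h
    -- 1/2 ≤ √x ⇒ 1/4 ≤ x ⇒ R - 1 ≤ 8
    have h2 : (1 / 2 : ℝ) ≤ Real.sqrt (2 / ((R : ℝ) - 1)) := by linarith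
    have h3 : (1 / 2 : ℝ) ^ 2 ≤ 2 / ((R : ℝ) - 1) := by
      have := Real.sq_sqrt hx
      nlinarith [Real.sqrt_nonneg (2 / ((R : ℝ) - 1))]
    have h4 : (R : ℝ) - 1 ≤ 8 := by
      rw [le_div_iff₀ hR1] at h3
      nlinarith
    have h5 : (R : ℝ) ≤ 9 := by linarith
    exact_mod_cast h5
  · intro h
    have h5 : (R : ℝ) ≤ 9 := by exact_mod_cast h
    have h3 : (1 / 2 : ℝ) ^ 2 ≤ 2 / ((R : ℝ) - 1) := by
      rw [le_div_iff₀ hR1]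
      nlinarith
    have h2 : (1 / 2 : ℝ) ≤ Real.sqrt (2 / ((R : ℝ) - 1)) :=
      Real.le_sqrt_of_sq_le h3
    linarith

/-- **The replica gate is unsatisfiable for `2 ≤ R ≤ 9`.**  With A's error assignment
`δτ_rep = τ_rep √(2/(R−1))`, the Ruling-11 gate `τ_rep − τ_base > 2 √(δτ_base² + δτ_rep²)` fails for
every `τ_base > 0`, every `δτ_base` and every real `τ_rep` (scorer A prints `τ_rep` for `R ≥ 4`; the
exercise of record has `R ∈ {4, 8}` on every analysis that prints it). -/
theorem replicaGate_fails {R : ℕ} (hR : 2 ≤ R) (hR9 : R ≤ 9) {τb δb τr : ℝ} (hτb : 0 < τb) :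
    ¬ (τr - τb > 2 * Real.sqrt (δb ^ 2 + (τr * Real.sqrt (2 / ((R : ℝ) - 1))) ^ 2)) := by
  have hq : (1 : ℝ) ≤ 2 * Real.sqrt (2 / ((R : ℝ) - 1)) := (one_le_two_mul_sqrt_iff hR).mpr hR9
  have hs : 0 ≤ Real.sqrt (2 / ((R : ℝ) - 1)) := Real.sqrt_nonneg _
  rcases le_or_gt 0 τr with hτr | hτr
  · -- τ_rep ≥ 0: its error is at least half its value
    refine gate_fails_of_le_two_mul_err hτb (mul_nonneg hτr hs) ?_
    nlinarith
  · -- τ_rep < 0: the left side is negative, the right side is not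
    intro hgate
    have : 0 ≤ 2 * Real.sqrt (δb ^ 2 + (τr * Real.sqrt (2 / ((R : ℝ) - 1))) ^ 2) := by positivity
    linarith

/-- **Necessary condition for a pass at any `R ≥ 2`**: `τ_base < τ_rep · (1 − 2 √(2/(R−1)))`.  In
particular a pass needs `1 − 2 √(2/(R−1)) > 0`, i.e. `R ≥ 10`, and then a ratio `τ_rep / τ_base`
above `1 / (1 − 2 √(2/(R−1)))` before `δτ_base` is even counted. -/
theorem ratio_gt_of_replicaGate {R : ℕ} {τb δb τr : ℝ} (hτb : 0 < τb)
    (hgate : τr - τb > 2 * Real.sqrt (δb ^ 2 + (τr * Real.sqrt (2 / ((R : ℝ) - 1))) ^ 2)) :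
    τb < τr * (1 - 2 * Real.sqrt (2 / ((R : ℝ) - 1))) := by
  have hs : 0 ≤ Real.sqrt (2 / ((R : ℝ) - 1)) := Real.sqrt_nonneg _
  have hpos : 0 ≤ 2 * Real.sqrt (δb ^ 2 + (τr * Real.sqrt (2 / ((R : ℝ) - 1))) ^ 2) := by
    positivity
  have hτr : 0 ≤ τr := by linarith
  have h1 : τr * Real.sqrt (2 / ((R : ℝ) - 1))
      ≤ Real.sqrt (δb ^ 2 + (τr * Real.sqrt (2 / ((R : ℝ) - 1))) ^ 2) := by
    calc τr * Real.sqrt (2 / ((R : ℝ) - 1))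
        = Real.sqrt ((τr * Real.sqrt (2 / ((R : ℝ) - 1))) ^ 2) :=
          (Real.sqrt_sq (mul_nonneg hτr hs)).symm
      _ ≤ Real.sqrt (δb ^ 2 + (τr * Real.sqrt (2 / ((R : ℝ) - 1))) ^ 2) :=
          Real.sqrt_le_sqrt (by nlinarith [sq_nonneg δb])
  nlinarith

/-- Instance `R = 10`: a pass would need `τ_rep > 17 τ_base` (`1 − 2 √(2/9) < 1/17`). -/
theorem replicaGate_R10_ratio {τb δb τr : ℝ} (hτb : 0 < τb)
    (hgate : τr - τb > 2 * Real.sqrt (δb ^ 2 + (τr * Real.sqrt (2 / (((10 : ℕ) : ℝ) - 1))) ^ 2)) :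
    17 * τb < τr := by
  have h := ratio_gt_of_replicaGate (R := 10) hτb hgate
  have hτr : 0 < τr := by
    have hpos : 0 ≤ 2 * Real.sqrt (δb ^ 2 + (τr * Real.sqrt (2 / (((10 : ℕ) : ℝ) - 1))) ^ 2) := by
      positivity
    linarith
  -- √(2/9) > 8/17, hence 1 - 2 √(2/9) < 1/17
  have hnum : (2 : ℝ) / (((10 : ℕ) : ℝ) - 1) = 2 / 9 := by norm_num
  rw [hnum] at h
  have hsq : (8 / 17 : ℝ) < Real.sqrt (2 / 9) := by
    rw [show (8 / 17 : ℝ) = Real.sqrt ((8 / 17) ^ 2) by rw [Real.sqrt_sq]; norm_num]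
    exact Real.sqrt_lt_sqrt (by norm_num) (by norm_num)
  nlinarith

/-- Instance `R = 19`: `√(2/18) = 1/3`, so a pass would need `τ_rep > 3 τ_base` exactly. -/
theorem replicaGate_R19_ratio {τb δb τr : ℝ} (hτb : 0 < τb)
    (hgate : τr - τb > 2 * Real.sqrt (δb ^ 2 + (τr * Real.sqrt (2 / (((19 : ℕ) : ℝ) - 1))) ^ 2)) :
    3 * τb < τr := by
  have h := ratio_gt_of_replicaGate (R := 19) hτb hgate
  have hnum : (2 : ℝ) / (((19 : ℕ) : ℝ) - 1) = (1 / 3) ^ 2 := by norm_num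
  rw [hnum, Real.sqrt_sq (by norm_num)] at h
  linarith

/-- **Sharpness**: for every `R ≥ 10` the gate is satisfiable — witness `τ_base = 1/20`,
`δτ_base = 0`, `τ_rep = 1` (then `2 √(2/(R−1)) ≤ 2 √(2/9) < 19/20`).  So `R ≤ 9` in
`replicaGate_fails` is the exact range, not a convenience. -/
theorem replicaGate_satisfiable_of_ten_le {R : ℕ} (hR : 10 ≤ R) :
    ∃ τb δb τr : ℝ, 0 < τb ∧ 0 ≤ δb ∧ 0 < τr ∧
      τr - τb > 2 * Real.sqrt (δb ^ 2 + (τr * Real.sqrt (2 / ((R : ℝ) - 1))) ^ 2) := by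
  refine ⟨1 / 20, 0, 1, by norm_num, le_rfl, by norm_num, ?_⟩
  have hR' : (10 : ℝ) ≤ (R : ℝ) := by exact_mod_cast hR
  have hR1 : (0 : ℝ) < (R : ℝ) - 1 := by linarith
  have hx : (0 : ℝ) ≤ 2 / ((R : ℝ) - 1) := by positivity
  have hle : 2 / ((R : ℝ) - 1) ≤ 2 / 9 := by
    rw [div_le_div_iff₀ hR1 (by norm_num)]
    nlinarith
  have e : Real.sqrt ((0 : ℝ) ^ 2 + (1 * Real.sqrt (2 / ((R : ℝ) - 1))) ^ 2)
      = Real.sqrt (2 / ((R : ℝ) - 1)) := by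
    rw [one_mul, Real.sq_sqrt hx]
    simp
  rw [e]
  have hlt : Real.sqrt (2 / ((R : ℝ) - 1)) < 19 / 40 := by
    rw [Real.sqrt_lt' (by norm_num)]
    linarith
  linarith

/-- **Record instance (LEADERBOARD l.101, plaquette, `R = 4`)**: `τ_base = 6.599…`,
`δτ_base = 0.156…`, `τ_rep = 23.681…` — the gate fails (by `replicaGate_fails`; numerically the
excess `17.08` is below the threshold `38.67` by a factor `2.3`).  Scorer A 0.1.2 had used
`τ_rep` there through an ungated `max()`; under Ruling 11 the long-window value is used instead. -/
theorem l101_plaquette_replicaGate_fails :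
    ¬ ((23.681449948209213 : ℝ) - 6.599476792145024
        > 2 * Real.sqrt ((0.15603335342199276 : ℝ) ^ 2
            + (23.681449948209213 * Real.sqrt (2 / (((4 : ℕ) : ℝ) - 1))) ^ 2)) :=
  replicaGate_fails (R := 4) (by norm_num) (by norm_num) (by norm_num)

end Summit.Ventures.LatticeQCDFlow.Scoring
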